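import Summits.QuantumFields.BalabanUV.Beta.MultiscaleGlobalMember

/-!
# `Summit.QuantumFields.BalabanUV.Beta.MultiscaleGlobalOfLocal` — engine file 21a: «THE GLOBAL INEQUALITIES (3.47) ARE CONSEQUENCES
# OF THE LOCAL ONES (3.42) AND LEMMA 2.1» AS ONE ABSTRACT THEOREM — for ANY linear map `G : (Y → ℝ) →ₗ[ℝ] (X → ℝ)` between index
# types sited on the torus, a LOCAL member «source in ONE cell k′, |v| ≤ m ⟹ |G v ξ| ≤ B·n(pos ξ)^α·e^{−κ₂·d_n}·m» plus the additive
# grading plus a growth clause on the cell family give the GLOBAL member «|u(y)| ≤ n(sit y)^γ·U ⟹ |G u ξ| ≤ B′·n(pos ξ)^α·n(pos ξ)^γ·U»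
# in print's scale-weighted sup norms (3.41) — file 13's bookkeeping (there: `G = (levelOp)⁻¹`, `α = 2`) done ONCE for all four
# members of (3.47)

HONEST FRAMING (page 1 of everything in this cell).  Discharging `FlowStep.BetaPertH` would make Bałaban's ultraviolet
stability UNCONDITIONAL — a constructive-QFT result; it is NOT the continuum limit and NOT the Clay problem.  This module
discharges nothing of `BetaPertH`; it is [folklore] finite-dimensional bookkeeping, kernel-checked, by the OWNER of binder row D4
(unit `b2b-balaban-beta-an4`, gen 47).  HONEST DEPENDENCY: continuum YM on T⁴ ⇐ BetaPertH ∧ nine spine estimates (0/9 proved);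
BetaPertH ⇐ (D1) ∧ (D4) ∧ CAP+tail; G-an2-4 gates asym, D1 and NE2/3/4.

THE POINT.  [B9] p. 398: «It is easy to see that the global inequalities (3.47) are consequences of the local ones (3.42) and Lemma
2.1» — no derivation printed (GAPS G-B9-03a).  File 13 `MultiscaleGlobalMember` made the step explicit for the FIRST member
`|G′u|_{(2+γ)} ≲ |u|_{(γ)}` of the MODEL operator.  The step uses NOTHING about `(levelOp)⁻¹` except linearity and the shape of its
local member, so THIS FILE states it for an ARBITRARY linear `G` from functions on a source index type `Y` (sited by `sit : Y → UT N`: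
sites × colours, bonds × colours, …) to functions on a target index type `X` (sited by `pos : X → UT N`), an arbitrary natural power
`α` of the target scale (print's `(L^jη)^{2}, (L^jη)^{1}, (L^jη)^{1}, 1` for the four members of (3.47)) and an arbitrary rate `κ₂`:
* **`real_global_of_local_growth`** — LOCAL member in CELL-CENTRE form «`v` vanishing off cell `k′`, `|v| ≤ m` ⟹
  `|G v ξ| ≤ B·n(pos ξ)^α·e^{−κ₂·d_n(t_{k(pos ξ)}, t_{k′})}·m`» + graded sides `S_l = L^{e_l}` with the sitewise additive datum
  `|e(x) − e(y)| ≤ A + d_n(x,y)/R` + a growth clause `#{k′ : d_n(t_k,t_{k′}) < m} ≤ N₀Λ^m` with `Λe^{−δ} < 1`, `δ := κ₂ − |γ|·log L/R ≥ 0`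
  ⟹ for EVERY `u` with `|u(y)| ≤ n(sit y)^γ·U` (`U ≥ 0`) and every `ξ`:
  `|G u ξ| ≤ B·(L^A)^{|γ|}·(N₀Λ/(1 − Λe^{−δ}))·n(pos ξ)^α·n(pos ξ)^γ·U`.
  Proof = file 13's: `u = Σ_{k′} u·1_{cell k′}`, linearity, the local member per source cell with `m_{k′} = S_{l_{k′}}^γ·U`, the graded
  exchange `S_{l_{k′}}^γ ≤ (L^A·e^{(log L/R)·d_n(t_k,t_{k′})})^{|γ|}·n(pos ξ)^γ` (`rpow_exchange`, both signs of `γ`), and beta-d4-p2's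
  `sum_exp_neg_le_of_growth`;
* **`real_global_of_local_grading`** — the growth clause DISCHARGED by beta-d4-p3's `cell_growth_add` (free `ε > 0`);
* **`real_global_of_local_grading_pt`** — the same from the LOCAL member in POINTWISE form «`e^{−κ₂·d_n(pos ξ, t_{k′})}`» (the shape
  of files 9b∕17∕19b∕19c), `κ₂ ≥ 0`, at the cost `e^{2dκ₂}` of the target-cell floor `d_n(pos ξ,t_{k′}) ≥ d_n(t_{k(pos ξ)},t_{k′}) − 2d`
  (`sdist_corner_thresholds`).
Constants see `B, L, A, R, κ₂, γ, ε, d` only — print's «for γ in a fixed compact subset of real numbers».  INSTANCES (file 21b and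
later): (3.47)₁ (`G = (levelOp)⁻¹`, α = 2: files 17∕18), (3.47)₂ (`G = D∘(levelOp)⁻¹`, α = 1, flat: 19b∕19c), (3.47)₄ (`G = D*D∘(levelOp)⁻¹`,
α = 0: 10b), (3.47)₃ (α = 1) the day the local member (3.42)₃ exists at MODEL level.

LOCATORS (shape only, nothing printed asserted; ABSOLUTE RULE): [Balaban1985BackgroundPropagators] (3.41) + Thm 3.1 (3.42), (3.47)
pp. 397–398; [Balaban1984PropagatorsII] Lemma 2.1 (2.61) p. 234.  Row D4: NO class change (critical-path width 0; D4 DISCHARGE NO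
DATE); NOT BetaPertH, NOT continuum, NOT Clay, NOT summit progress.
-/

open scoped BigOperators
open Finset

namespace Summit.QuantumFields.BalabanUV.Beta.MultiscaleGlobalOfLocal

open Summit.QuantumFields.BalabanUV.Beta.MultiscaleGlobalMember (rpow_exchange)
open Summit.QuantumFields.BalabanUV.Beta.MultiscaleCombesThomasL2CellsGraded (siteScale_ctrU)
open Summit.QuantumFields.BalabanUV.Beta.MultiscaleGrowthCells (cell_growth_add)
open Summit.QuantumFields.BalabanUV.Beta.MultiscaleDecayRowSums (sum_exp_neg_le_of_growth)
open Summit.QuantumFields.BalabanUV.Beta.BoxPoincare (Box)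
open Summit.QuantumFields.BalabanUV.Beta.MultiscaleCoerciveTorus
open Summit.QuantumFields.BalabanUV.Beta.MultiscaleDistance
open Summit.QuantumFields.BalabanUV.Beta.MultiscaleDistanceGraded (scale_le_scale_mul_exp_add)
open Summit.QuantumFields.BalabanUV.Beta.MultiscaleDistanceMetric (sdist_comm)
open Summit.QuantumFields.BalabanUV.Beta.MultiscaleDecayBudget
open Summit.QuantumFields.BalabanUV.Beta.AccretiveCombesThomasSandwichSite (sdist_corner_thresholds)
open Literature.MathematicalPhysics.QuantumFieldTheory.Balaban1983to89
open Literature.MathematicalPhysics.QuantumFieldTheory.Balaban1983to89.B9Thm37GluePU (bsrc btgt)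
open B5TorusCover (UT Ctr ctrU)

noncomputable section

variable {d : ℕ} {N : Fin d → ℕ} [∀ i, NeZero (N i)] [NeZero d] {J K : Type} [Fintype K] [DecidableEq K]
  (S : J → ℕ) (hS : ∀ l, 1 ≤ S l) (hdivS : ∀ l i, S l ∣ N i) (lvl : K → J) (zc : (k : K) → Ctr N (S (lvl k)))
  (hdisj : ∀ k k' v v', cellPt S hS hdivS lvl zc k v = cellPt S hS hdivS lvl zc k' v' → k = k')
  (hcover : ∀ x : UT N, ∃ k, ∃ v : Box d (S (lvl k)), cellPt S hS hdivS lvl zc k v = x)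

include hdisj

/-! ## §1 The global member from a local member in cell-centre form and an abstract growth clause -/

omit [NeZero d] in
/-- **LOCAL ⟹ GLOBAL, ABSTRACT (cell-centre form, abstract growth clause).**  A disjoint covering cube family with graded sides
`S_l = L^{e_l}` (`1 ≤ L`, `0 < R`) and the sitewise additive datum; a linear `G : (Y → ℝ) →ₗ[ℝ] (X → ℝ)` with siting maps
`sit : Y → UT N`, `pos : X → UT N`; a natural power `α`, a rate `κ₂` and a constant `B ≥ 0` for which the LOCAL member holds: for every
cell `k′`, every `v` vanishing off `{y : cellOf (sit y) = k′}` with `|v| ≤ m` (`m ≥ 0`) and every `ξ`,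
`|G v ξ| ≤ B·n(pos ξ)^α·e^{−κ₂·d_n(t_{k(pos ξ)}, t_{k′})}·m`; a real `γ` with `δ := κ₂ − |γ|·log L/R ≥ 0`; a growth clause
`#{k′ : d_n(t_k,t_{k′}) < m} ≤ N₀Λ^m` with `Λe^{−δ} < 1`.  Then for every `u` with `|u(y)| ≤ n(sit y)^γ·U` (`U ≥ 0`) and every `ξ`:
`|G u ξ| ≤ B·(L^A)^{|γ|}·(N₀Λ/(1 − Λe^{−δ}))·n(pos ξ)^α·n(pos ξ)^γ·U`.
[cite: Balaban1985BackgroundPropagators, (3.47) p.398 + (3.41)-(3.42) p.397; Balaban1984PropagatorsII, Lemma 2.1 (2.61) p.234] [folklore] -/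
theorem real_global_of_local_growth {X Y : Type} (G : (Y → ℝ) →ₗ[ℝ] (X → ℝ)) (sit : Y → UT N) (pos : X → UT N) (α : ℕ)
    {B κ₂ : ℝ} (hB : 0 ≤ B)
    (hloc : ∀ (k' : K) (v : Y → ℝ), (∀ y, cellOf S hS hdivS lvl zc hcover (sit y) ≠ k' → v y = 0) →
      ∀ (m : ℝ), 0 ≤ m → (∀ y, |v y| ≤ m) → ∀ ξ : X,
        |G v ξ| ≤ B * (siteScale S hS hdivS lvl zc hcover (pos ξ) : ℝ) ^ α *
          Real.exp (-(κ₂ * sdist bsrc btgt (siteScale S hS hdivS lvl zc hcover)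
            (ctrU N (S (lvl (cellOf S hS hdivS lvl zc hcover (pos ξ)))) (zc (cellOf S hS hdivS lvl zc hcover (pos ξ))))
            (ctrU N (S (lvl k')) (zc k')))) * m)
    {L : ℕ} (hL : 1 ≤ L) (e : J → ℕ) (hSe : ∀ l, S l = L ^ e l) {R : ℝ} (hR : 0 < R) {A : ℕ}
    (hadd : ∀ x y : UT N, |(e (lvl (cellOf S hS hdivS lvl zc hcover x)) : ℝ) - e (lvl (cellOf S hS hdivS lvl zc hcover y))| ≤
      A + sdist bsrc btgt (siteScale S hS hdivS lvl zc hcover) x y / R)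
    {γ : ℝ} (hδ : 0 ≤ κ₂ - |γ| * (Real.log L / R))
    {N₀ Λ : ℝ} (hN₀ : 0 ≤ N₀) (hΛ : 0 ≤ Λ)
    (hcount : ∀ (k : K) (m : ℕ), ((univ.filter fun k' => sdist bsrc btgt (siteScale S hS hdivS lvl zc hcover)
        (ctrU N (S (lvl k)) (zc k)) (ctrU N (S (lvl k')) (zc k')) < m).card : ℝ) ≤ N₀ * Λ ^ m)
    (hq : Λ * Real.exp (-(κ₂ - |γ| * (Real.log L / R))) < 1)
    (u : Y → ℝ) {U : ℝ} (hU : 0 ≤ U) (hu : ∀ y, |u y| ≤ (siteScale S hS hdivS lvl zc hcover (sit y) : ℝ) ^ γ * U)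
    (ξ : X) :
    |G u ξ| ≤ B * ((L : ℝ) ^ A) ^ |γ| * (N₀ * Λ / (1 - Λ * Real.exp (-(κ₂ - |γ| * (Real.log L / R))))) *
      (siteScale S hS hdivS lvl zc hcover (pos ξ) : ℝ) ^ α * (siteScale S hS hdivS lvl zc hcover (pos ξ) : ℝ) ^ γ * U := by
  classical
  -- the decomposition of the source over cells
  set uk : K → Y → ℝ := fun k' y => if cellOf S hS hdivS lvl zc hcover (sit y) = k' then u y else 0 with huk
  -- the local member per source cell, BEFORE the abbreviations
  have hlk : ∀ k', |G (uk k') ξ| ≤ B * (siteScale S hS hdivS lvl zc hcover (pos ξ) : ℝ) ^ α *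
      Real.exp (-(κ₂ * sdist bsrc btgt (siteScale S hS hdivS lvl zc hcover)
        (ctrU N (S (lvl (cellOf S hS hdivS lvl zc hcover (pos ξ)))) (zc (cellOf S hS hdivS lvl zc hcover (pos ξ))))
        (ctrU N (S (lvl k')) (zc k')))) * ((S (lvl k') : ℝ) ^ γ * U) := by
    intro k'
    refine hloc k' (uk k') (fun y hy => by simp only [huk, if_neg hy]) _
      (mul_nonneg (Real.rpow_nonneg (Nat.cast_nonneg _) γ) hU) (fun y => ?_) ξ
    by_cases hy : cellOf S hS hdivS lvl zc hcover (sit y) = k'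
    · simp only [huk, hy, if_true]
      have h := hu y
      have hn : (siteScale S hS hdivS lvl zc hcover (sit y) : ℝ) = S (lvl k') := by rw [siteScale, hy]
      rwa [hn] at h
    · simp only [huk, hy, if_false, abs_zero]
      exact mul_nonneg (Real.rpow_nonneg (Nat.cast_nonneg _) γ) hU
  -- abbreviations
  set n := siteScale S hS hdivS lvl zc hcover with hn
  set t : ℝ := Real.log L / R with ht
  set δ : ℝ := κ₂ - |γ| * t with hδdef
  set x := pos ξ with hx
  set kx := cellOf S hS hdivS lvl zc hcover x with hkx
  set Dc : K → ℝ := fun k' => sdist bsrc btgt n (ctrU N (S (lvl kx)) (zc kx)) (ctrU N (S (lvl k')) (zc k')) with hDc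
  have hL0 : (0 : ℝ) < L := by exact_mod_cast hL
  have ht0 : 0 ≤ t := div_nonneg (Real.log_nonneg (by exact_mod_cast hL)) hR.le
  have hnpos : ∀ y, (0 : ℝ) < (n y : ℝ) := fun y => by exact_mod_cast one_le_siteScale S hS hdivS lvl zc hcover y
  have hSpos : ∀ l, (0 : ℝ) < (S l : ℝ) := fun l => by exact_mod_cast hS l
  -- the grading at the cell centres
  have hgr : ∀ y, n y = L ^ (e (lvl (cellOf S hS hdivS lvl zc hcover y))) := fun y => by rw [hn, siteScale, hSe]
  have hntk' : ∀ k', (n (ctrU N (S (lvl k')) (zc k')) : ℝ) = S (lvl k') := fun k' => by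
    rw [hn, siteScale_ctrU S hS hdivS lvl zc hdisj hcover k']
  have hnx : (n x : ℝ) = S (lvl kx) := by rw [hn, hkx, siteScale]
  -- the exchange of the real power at the pair of centres `(t_{k_x}, t_{k′})`
  have hexch : ∀ k', ((S (lvl k') : ℝ)) ^ γ ≤ ((L : ℝ) ^ A * Real.exp (t * Dc k')) ^ |γ| * (n x : ℝ) ^ γ := by
    intro k'
    have h1 := scale_le_scale_mul_exp_add bsrc btgt n hL (fun y => e (lvl (cellOf S hS hdivS lvl zc hcover y))) hgr (A := A)
      (hadd (ctrU N (S (lvl kx)) (zc kx)) (ctrU N (S (lvl k')) (zc k')))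
    have h2 := scale_le_scale_mul_exp_add bsrc btgt n hL (fun y => e (lvl (cellOf S hS hdivS lvl zc hcover y))) hgr (A := A)
      (hadd (ctrU N (S (lvl k')) (zc k')) (ctrU N (S (lvl kx)) (zc kx)))
    rw [hntk', hntk'] at h1 h2
    rw [sdist_comm bsrc btgt n (ctrU N (S (lvl k')) (zc k')) (ctrU N (S (lvl kx)) (zc kx))] at h2
    have h1' : (S (lvl k') : ℝ) ≤ ((L : ℝ) ^ A * Real.exp (t * Dc k')) * n x := by
      calc (S (lvl k') : ℝ) ≤ (L : ℝ) ^ A * S (lvl kx) *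
            Real.exp (Real.log L / R * sdist bsrc btgt n (ctrU N (S (lvl kx)) (zc kx)) (ctrU N (S (lvl k')) (zc k'))) := h1
        _ = ((L : ℝ) ^ A * Real.exp (t * Dc k')) * n x := by rw [hnx]; simp only [ht, hDc]; ring
    have h2' : (n x : ℝ) ≤ ((L : ℝ) ^ A * Real.exp (t * Dc k')) * S (lvl k') := by
      calc (n x : ℝ) = S (lvl kx) := hnx
        _ ≤ (L : ℝ) ^ A * S (lvl k') *
            Real.exp (Real.log L / R * sdist bsrc btgt n (ctrU N (S (lvl kx)) (zc kx)) (ctrU N (S (lvl k')) (zc k'))) := h2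
        _ = ((L : ℝ) ^ A * Real.exp (t * Dc k')) * S (lvl k') := by simp only [ht, hDc]; ring
    have hC1 : (1 : ℝ) ≤ (L : ℝ) ^ A * Real.exp (t * Dc k') := by
      have hLA : (1 : ℝ) ≤ (L : ℝ) ^ A := one_le_pow₀ (by exact_mod_cast hL)
      have : (1 : ℝ) ≤ Real.exp (t * Dc k') := Real.one_le_exp_iff.mpr (mul_nonneg ht0 (sdist_nonneg bsrc btgt n _ _))
      nlinarith
    exact rpow_exchange (hSpos _) (hnpos x) hC1 h1' h2'
  -- per source cell: the summand of the final bound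
  have hterm : ∀ k', |G (uk k') ξ| ≤ B * ((L : ℝ) ^ A) ^ |γ| * (n x : ℝ) ^ α * (n x : ℝ) ^ γ * U *
      Real.exp (-(δ * Dc k')) := by
    intro k'
    have h0 : |G (uk k') ξ| ≤ B * (n x : ℝ) ^ α * Real.exp (-(κ₂ * Dc k')) * ((S (lvl k') : ℝ) ^ γ * U) := by
      have := hlk k'
      simpa only [hn, hx, hkx, hDc] using this
    have h1 : ((S (lvl k') : ℝ)) ^ γ * U ≤ ((L : ℝ) ^ A * Real.exp (t * Dc k')) ^ |γ| * (n x : ℝ) ^ γ * U :=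
      mul_le_mul_of_nonneg_right (hexch k') hU
    have hpre : 0 ≤ B * (n x : ℝ) ^ α * Real.exp (-(κ₂ * Dc k')) := by
      have := pow_nonneg (hnpos x).le α
      positivity
    have h2 := mul_le_mul_of_nonneg_left h1 hpre
    have hsplit : ((L : ℝ) ^ A * Real.exp (t * Dc k')) ^ |γ| = ((L : ℝ) ^ A) ^ |γ| * Real.exp (|γ| * (t * Dc k')) := by
      rw [Real.mul_rpow (pow_nonneg hL0.le A) (Real.exp_pos _).le, ← Real.exp_mul, mul_comm (t * Dc k') |γ|]
    have hexpc : Real.exp (-(κ₂ * Dc k')) * Real.exp (|γ| * (t * Dc k')) = Real.exp (-(δ * Dc k')) := by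
      rw [← Real.exp_add, hδdef]; congr 1; ring
    calc |G (uk k') ξ| ≤ B * (n x : ℝ) ^ α * Real.exp (-(κ₂ * Dc k')) *
          (((L : ℝ) ^ A * Real.exp (t * Dc k')) ^ |γ| * (n x : ℝ) ^ γ * U) := h0.trans h2
      _ = B * ((L : ℝ) ^ A) ^ |γ| * (n x : ℝ) ^ α * (n x : ℝ) ^ γ * U *
            (Real.exp (-(κ₂ * Dc k')) * Real.exp (|γ| * (t * Dc k'))) := by rw [hsplit]; ring
      _ = _ := by rw [hexpc]
  -- the lattice sum over source cells (beta-d4-p2's growth summation)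
  have hδ0 : 0 ≤ δ := by rw [hδdef, ht]; exact hδ
  have hsum : ∑ k', Real.exp (-(δ * Dc k')) ≤ N₀ * Λ / (1 - Λ * Real.exp (-δ)) := by
    have hq' : Λ * Real.exp (-δ) < 1 := by simpa only [hδdef, ht] using hq
    exact sum_exp_neg_le_of_growth Dc (fun k' => sdist_nonneg bsrc btgt n _ _) hN₀ hΛ
      (fun m => by simpa only [hDc, hn, hkx] using hcount kx m) hδ0 hq'
  -- assemble: decomposition + linearity + triangle inequality
  have hdec : u = ∑ k', uk k' := by
    funext y
    rw [Finset.sum_apply]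
    simp only [huk]
    rw [Finset.sum_ite_eq]
    simp
  have hlin : G u ξ = ∑ k', G (uk k') ξ := by
    rw [hdec, map_sum, Finset.sum_apply]
  rw [hlin]
  have hK : 0 ≤ B * ((L : ℝ) ^ A) ^ |γ| * (n x : ℝ) ^ α * (n x : ℝ) ^ γ * U := by
    have h1 : 0 ≤ (n x : ℝ) ^ γ := Real.rpow_nonneg (hnpos x).le γ
    have h2 : 0 ≤ (n x : ℝ) ^ α := pow_nonneg (hnpos x).le α
    positivity
  calc |∑ k', G (uk k') ξ| ≤ ∑ k', |G (uk k') ξ| := Finset.abs_sum_le_sum_abs _ _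
    _ ≤ ∑ k', B * ((L : ℝ) ^ A) ^ |γ| * (n x : ℝ) ^ α * (n x : ℝ) ^ γ * U * Real.exp (-(δ * Dc k')) :=
        Finset.sum_le_sum fun k' _ => hterm k'
    _ = B * ((L : ℝ) ^ A) ^ |γ| * (n x : ℝ) ^ α * (n x : ℝ) ^ γ * U * ∑ k', Real.exp (-(δ * Dc k')) := by
        rw [Finset.mul_sum]
    _ ≤ B * ((L : ℝ) ^ A) ^ |γ| * (n x : ℝ) ^ α * (n x : ℝ) ^ γ * U * (N₀ * Λ / (1 - Λ * Real.exp (-δ))) :=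
        mul_le_mul_of_nonneg_left hsum hK
    _ = _ := by simp only [hδdef, ht]; ring

/-! ## §2 The growth clause DISCHARGED by the grading (beta-d4-p3's `cell_growth_add`) -/

/-- **LOCAL ⟹ GLOBAL, cell-centre form, growth clause discharged**: as `real_global_of_local_growth` with
`N₀ = (3(L^A)²)^d·(d!/ε^d)·e^{2d(ε + (log L/R)d)}`, `Λ = e^{ε + 2(log L/R)d}` supplied by beta-d4-p3's `MultiscaleGrowthCells.cell_growth_add`
from the SAME sitewise additive datum (free `ε > 0`).
[cite: Balaban1985BackgroundPropagators, (3.47) p.398; Balaban1984PropagatorsII, Lemma 2.1 (2.61) p.234 + (2.1)-(2.2) p.224] [folklore] -/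
theorem real_global_of_local_grading {X Y : Type} (G : (Y → ℝ) →ₗ[ℝ] (X → ℝ)) (sit : Y → UT N) (pos : X → UT N) (α : ℕ)
    {B κ₂ : ℝ} (hB : 0 ≤ B)
    (hloc : ∀ (k' : K) (v : Y → ℝ), (∀ y, cellOf S hS hdivS lvl zc hcover (sit y) ≠ k' → v y = 0) →
      ∀ (m : ℝ), 0 ≤ m → (∀ y, |v y| ≤ m) → ∀ ξ : X,
        |G v ξ| ≤ B * (siteScale S hS hdivS lvl zc hcover (pos ξ) : ℝ) ^ α *
          Real.exp (-(κ₂ * sdist bsrc btgt (siteScale S hS hdivS lvl zc hcover)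
            (ctrU N (S (lvl (cellOf S hS hdivS lvl zc hcover (pos ξ)))) (zc (cellOf S hS hdivS lvl zc hcover (pos ξ))))
            (ctrU N (S (lvl k')) (zc k')))) * m)
    {L : ℕ} (hL : 1 ≤ L) (e : J → ℕ) (hSe : ∀ l, S l = L ^ e l) {R : ℝ} (hR : 0 < R) {A : ℕ}
    (hadd : ∀ x y : UT N, |(e (lvl (cellOf S hS hdivS lvl zc hcover x)) : ℝ) - e (lvl (cellOf S hS hdivS lvl zc hcover y))| ≤
      A + sdist bsrc btgt (siteScale S hS hdivS lvl zc hcover) x y / R)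
    {γ : ℝ} (hδ : 0 ≤ κ₂ - |γ| * (Real.log L / R)) {ε : ℝ} (hε : 0 < ε)
    (hq : Real.exp (ε + 2 * (Real.log L / R) * d) * Real.exp (-(κ₂ - |γ| * (Real.log L / R))) < 1)
    (u : Y → ℝ) {U : ℝ} (hU : 0 ≤ U) (hu : ∀ y, |u y| ≤ (siteScale S hS hdivS lvl zc hcover (sit y) : ℝ) ^ γ * U)
    (ξ : X) :
    |G u ξ| ≤ B * ((L : ℝ) ^ A) ^ |γ| *
        ((3 * ((L : ℝ) ^ A) ^ 2) ^ d * ((d.factorial : ℝ) / ε ^ d) * Real.exp (2 * d * (ε + Real.log L / R * d)) *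
            Real.exp (ε + 2 * (Real.log L / R) * d) /
          (1 - Real.exp (ε + 2 * (Real.log L / R) * d) * Real.exp (-(κ₂ - |γ| * (Real.log L / R))))) *
      (siteScale S hS hdivS lvl zc hcover (pos ξ) : ℝ) ^ α * (siteScale S hS hdivS lvl zc hcover (pos ξ) : ℝ) ^ γ * U := by
  have hgr : ∀ y, siteScale S hS hdivS lvl zc hcover y = L ^ (e (lvl (cellOf S hS hdivS lvl zc hcover y))) := fun y => by
    rw [siteScale, hSe]
  have hcount := fun (k : K) (m : ℕ) =>
    cell_growth_add S hS hdivS lvl zc hdisj hcover hL (fun y => e (lvl (cellOf S hS hdivS lvl zc hcover y))) hgr hR (A := A)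
      hadd hε k m
  exact real_global_of_local_growth S hS hdivS lvl zc hdisj hcover G sit pos α hB hloc hL e hSe hR hadd hδ (by positivity)
    (Real.exp_pos _).le hcount hq u hU hu ξ

/-! ## §3 From the local member in POINTWISE form (files 9b∕17∕19b∕19c) -/

/-- **LOCAL ⟹ GLOBAL from the POINTWISE local member**: if the local member is known with the decay measured from the TARGET POINT,
`|G v ξ| ≤ B·n(pos ξ)^α·e^{−κ₂·d_n(pos ξ, t_{k′})}·m` (`κ₂ ≥ 0`), then the cell-centre form holds with `B·e^{2dκ₂}` (target-cell floor
`d_n(pos ξ, t_{k′}) ≥ d_n(t_{k(pos ξ)}, t_{k′}) − 2d`, `sdist_corner_thresholds`), hence the GLOBAL member of `real_global_of_local_grading`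
with that constant. [cite: Balaban1985BackgroundPropagators, (3.47) p.398 + (3.42) p.397; Balaban1984PropagatorsII, Lemma 2.1 (2.61) p.234] [folklore] -/
theorem real_global_of_local_grading_pt {X Y : Type} (G : (Y → ℝ) →ₗ[ℝ] (X → ℝ)) (sit : Y → UT N) (pos : X → UT N) (α : ℕ)
    {B κ₂ : ℝ} (hB : 0 ≤ B) (hκ₂ : 0 ≤ κ₂)
    (hloc : ∀ (k' : K) (v : Y → ℝ), (∀ y, cellOf S hS hdivS lvl zc hcover (sit y) ≠ k' → v y = 0) →
      ∀ (m : ℝ), 0 ≤ m → (∀ y, |v y| ≤ m) → ∀ ξ : X,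
        |G v ξ| ≤ B * (siteScale S hS hdivS lvl zc hcover (pos ξ) : ℝ) ^ α *
          Real.exp (-(κ₂ * sdist bsrc btgt (siteScale S hS hdivS lvl zc hcover) (pos ξ) (ctrU N (S (lvl k')) (zc k')))) * m)
    {L : ℕ} (hL : 1 ≤ L) (e : J → ℕ) (hSe : ∀ l, S l = L ^ e l) {R : ℝ} (hR : 0 < R) {A : ℕ}
    (hadd : ∀ x y : UT N, |(e (lvl (cellOf S hS hdivS lvl zc hcover x)) : ℝ) - e (lvl (cellOf S hS hdivS lvl zc hcover y))| ≤
      A + sdist bsrc btgt (siteScale S hS hdivS lvl zc hcover) x y / R)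
    {γ : ℝ} (hδ : 0 ≤ κ₂ - |γ| * (Real.log L / R)) {ε : ℝ} (hε : 0 < ε)
    (hq : Real.exp (ε + 2 * (Real.log L / R) * d) * Real.exp (-(κ₂ - |γ| * (Real.log L / R))) < 1)
    (u : Y → ℝ) {U : ℝ} (hU : 0 ≤ U) (hu : ∀ y, |u y| ≤ (siteScale S hS hdivS lvl zc hcover (sit y) : ℝ) ^ γ * U)
    (ξ : X) :
    |G u ξ| ≤ B * Real.exp (2 * d * κ₂) * ((L : ℝ) ^ A) ^ |γ| *
        ((3 * ((L : ℝ) ^ A) ^ 2) ^ d * ((d.factorial : ℝ) / ε ^ d) * Real.exp (2 * d * (ε + Real.log L / R * d)) *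
            Real.exp (ε + 2 * (Real.log L / R) * d) /
          (1 - Real.exp (ε + 2 * (Real.log L / R) * d) * Real.exp (-(κ₂ - |γ| * (Real.log L / R))))) *
      (siteScale S hS hdivS lvl zc hcover (pos ξ) : ℝ) ^ α * (siteScale S hS hdivS lvl zc hcover (pos ξ) : ℝ) ^ γ * U := by
  -- the pointwise local member implies the cell-centre one with `B·e^{2dκ₂}`
  have hloc' : ∀ (k' : K) (v : Y → ℝ), (∀ y, cellOf S hS hdivS lvl zc hcover (sit y) ≠ k' → v y = 0) →
      ∀ (m : ℝ), 0 ≤ m → (∀ y, |v y| ≤ m) → ∀ ξ : X,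
        |G v ξ| ≤ B * Real.exp (2 * d * κ₂) * (siteScale S hS hdivS lvl zc hcover (pos ξ) : ℝ) ^ α *
          Real.exp (-(κ₂ * sdist bsrc btgt (siteScale S hS hdivS lvl zc hcover)
            (ctrU N (S (lvl (cellOf S hS hdivS lvl zc hcover (pos ξ)))) (zc (cellOf S hS hdivS lvl zc hcover (pos ξ))))
            (ctrU N (S (lvl k')) (zc k')))) * m := by
    intro k' v hv m hm hvm ξ
    have h0 := hloc k' v hv m hm hvm ξ
    have hthr := (sdist_corner_thresholds S hS hdivS lvl zc hdisj hcover (pos ξ) k').2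
    have hnn : 0 ≤ (siteScale S hS hdivS lvl zc hcover (pos ξ) : ℝ) ^ α := pow_nonneg (Nat.cast_nonneg _) α
    have hmono : Real.exp (-(κ₂ * sdist bsrc btgt (siteScale S hS hdivS lvl zc hcover) (pos ξ) (ctrU N (S (lvl k')) (zc k')))) ≤
        Real.exp (2 * d * κ₂) * Real.exp (-(κ₂ * sdist bsrc btgt (siteScale S hS hdivS lvl zc hcover)
          (ctrU N (S (lvl (cellOf S hS hdivS lvl zc hcover (pos ξ)))) (zc (cellOf S hS hdivS lvl zc hcover (pos ξ))))
          (ctrU N (S (lvl k')) (zc k')))) := by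
      rw [← Real.exp_add]
      exact Real.exp_le_exp.mpr (by nlinarith)
    calc |G v ξ| ≤ _ := h0
      _ ≤ B * (siteScale S hS hdivS lvl zc hcover (pos ξ) : ℝ) ^ α *
          (Real.exp (2 * d * κ₂) * Real.exp (-(κ₂ * sdist bsrc btgt (siteScale S hS hdivS lvl zc hcover)
            (ctrU N (S (lvl (cellOf S hS hdivS lvl zc hcover (pos ξ)))) (zc (cellOf S hS hdivS lvl zc hcover (pos ξ))))
            (ctrU N (S (lvl k')) (zc k'))))) * m :=
          mul_le_mul_of_nonneg_right (mul_le_mul_of_nonneg_left hmono (mul_nonneg hB hnn)) hm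
      _ = _ := by ring
  exact real_global_of_local_grading S hS hdivS lvl zc hdisj hcover G sit pos α (by positivity) hloc' hL e hSe hR hadd hδ hε
    hq u hU hu ξ

end

end Summit.QuantumFields.BalabanUV.Beta.MultiscaleGlobalOfLocal
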